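import Summits.Ventures.LatticeQCDFlow.Scoring.BlockFactorBartlett
import Summits.Ventures.LatticeQCDFlow.Scoring.MadrasSokalDataWindow

/-!
# The STRONG LAW for block-factor (`m`-dependent) processes: `(1/N) Σ_{i<N} X_i → E X_0` almost surely

HONEST FRAMING: exact (Metropolis-corrected) sampling algorithms for lattice gauge theory;
figures of merit are autocorrelation/cost numbers at stated couplings and volumes; no
continuum-physics claim.

Venture `LatticeQCDFlow` (cell pub-lqcd), sub-topic `Scoring`; FANOUT row 16 (`su2-base`), GEN-8.
NEW WORK of the cell over GEN-7's `Scoring/BlockFactorProcess` (`blockFactor`, stationarity,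
`indepFun_blockFactor`) and Mathlib's strong law `ProbabilityTheory.strong_law_ae_real` (pairwise
independent, identically distributed, integrable); no definition of a published notion; nothing cited
as a fact.  Printed counterpart NAMED ONLY: the strong law for `m`-dependent stationary sequences
(e.g. as a corollary of the ergodic theorem; here by RESIDUE CLASSES: for each `r ≤ m` the decimated
sequence `k ↦ X_{k(m+1)+r}` is i.i.d., so Etemadi's strong law applies class by class).

## Contents

* §1 combinatorics of decimation: `resCount m r N = (N + (m − r))/(m+1)` counts the `k` with
  `k(m+1) + r < N`; `resCount_succ`, **`sum_range_eq_sum_residues`**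
  (`Σ_{i<N} f i = Σ_{r≤m} Σ_{k<resCount m r N} f (k(m+1)+r)`), `tendsto_resCount_atTop`,
  `tendsto_resCount_div` (`resCount/N → 1/(m+1)`).
* §2 **`strong_law_blockFactor`** — `ξ` i.i.d., `F` measurable, `X_0 = F(ξ_0..ξ_m) ∈ L¹`:
  `∀ᵐ ω, (Σ_{i<N} X_i ω)/N → E X_0`.
* §3 **`ae_tendsto_acovHat_blockFactor`** — `Γ̂_N(t) → E[X_0X_t]` a.s. at every lag (lag products are
  block factors); **`ae_tendsto_tauIntWindow_blockFactor`** — `τ̂_N(W) → τ_W` a.s. for ALL `W` at once.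
* §4 **`ae_eventually_isMSWindow`** / `ae_eventually_windowSel_eq` (abstract) and
  **`ae_eventually_isMSWindow_blockFactor`** — THE DATA-CHOSEN WINDOW FREEZES: at a strict crossing,
  almost surely `w` is the Madras–Sokal window of `τ̂_N(·)` for all large `N` (strengthens
  `MadrasSokalDataWindow`'s `P(Ŵ_N ≠ w) → 0`).

NOT CLAIMED: rates (LIL), non-identically-driven sequences, Markov-chain data.
-/

noncomputable section

open MeasureTheory ProbabilityTheory Filter Finset
open scoped Topology

namespace Summit.Ventures.LatticeQCDFlow.Scoring

/-! ## §1 Decimation into residue classes -/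

section Residues

/-- The number of indices `k` with `k (m+1) + r < N` (`r ≤ m`): `(N + (m − r)) / (m + 1)`. [ours] -/
def resCount (m r N : ℕ) : ℕ := (N + (m - r)) / (m + 1)

/-- `k < resCount m r N ↔ k (m+1) + r < N` (for `r ≤ m`). -/
theorem lt_resCount_iff {m r N k : ℕ} (hr : r ≤ m) : k < resCount m r N ↔ k * (m + 1) + r < N := by
  unfold resCount
  rw [← Nat.add_one_le_iff, Nat.le_div_iff_mul_le (by omega : 0 < m + 1), add_mul, one_mul]
  have hmr : m - r + r = m := Nat.sub_add_cancel hr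
  omega

/-- **Decimation of a finite sum into residue classes**:
`Σ_{i<N} f i = Σ_{r≤m} Σ_{k<resCount m r N} f (k (m+1) + r)`. -/
theorem sum_range_eq_sum_residues {M : Type*} [AddCommMonoid M] (f : ℕ → M) (m N : ℕ) :
    ∑ i ∈ range N, f i = ∑ r ∈ range (m + 1), ∑ k ∈ range (resCount m r N), f (k * (m + 1) + r) := by
  rw [← Finset.sum_sigma (range (m + 1)) (fun r => range (resCount m r N)) (fun p => f (p.2 * (m + 1) + p.1))]
  symm
  refine Finset.sum_nbij' (fun p => p.2 * (m + 1) + p.1) (fun n => ⟨n % (m + 1), n / (m + 1)⟩)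
    ?_ ?_ ?_ ?_ ?_
  · rintro ⟨r, k⟩ hp
    simp only [Finset.mem_sigma, Finset.mem_range] at hp ⊢
    exact (lt_resCount_iff (Nat.le_of_lt_succ hp.1)).1 hp.2
  · intro n hn
    simp only [Finset.mem_sigma, Finset.mem_range] at hn ⊢
    refine ⟨Nat.mod_lt _ (Nat.succ_pos m), (lt_resCount_iff (Nat.le_of_lt_succ
      (Nat.mod_lt _ (Nat.succ_pos m)))).2 ?_⟩
    rw [Nat.div_add_mod']
    exact hn
  · rintro ⟨r, k⟩ hp
    simp only [Finset.mem_sigma, Finset.mem_range] at hp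
    have hr : r < m + 1 := hp.1
    ext
    · exact Nat.mul_add_mod_of_lt hr
    · simp only [heq_eq_eq]
      rw [Nat.add_comm, Nat.add_mul_div_right _ _ (Nat.succ_pos m), Nat.div_eq_of_lt hr, zero_add]
  · intro n hn
    exact Nat.div_add_mod' n (m + 1)
  · intro p hp
    rfl

/-- `resCount → ∞`. -/
theorem tendsto_resCount_atTop (m r : ℕ) : Tendsto (resCount m r) atTop atTop := by
  refine tendsto_atTop_atTop.2 fun b => ⟨b * (m + 1), fun N hN => ?_⟩
  unfold resCount
  rw [Nat.le_div_iff_mul_le (by omega : 0 < m + 1)]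
  omega

/-- **`resCount m r N / N → 1/(m+1)`**: each residue class carries a fraction `1/(m+1)` of the indices. -/
theorem tendsto_resCount_div {m r : ℕ} (hr : r ≤ m) :
    Tendsto (fun N : ℕ => (resCount m r N : ℝ) / N) atTop (𝓝 (1 / (m + 1 : ℝ))) := by
  have hm : (0 : ℝ) < m + 1 := by positivity
  -- two-sided bounds `N − (m+1) ≤ (m+1) K ≤ N + m`
  have hup : ∀ N : ℕ, ((m + 1 : ℕ) : ℝ) * resCount m r N ≤ (N : ℝ) + m := fun N => by
    have h : resCount m r N * (m + 1) ≤ N + (m - r) := Nat.div_mul_le_self _ _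
    have h' : (resCount m r N : ℝ) * (m + 1 : ℕ) ≤ ((N + (m - r) : ℕ) : ℝ) := by exact_mod_cast h
    have hmr : ((N + (m - r) : ℕ) : ℝ) ≤ (N : ℝ) + m := by
      have : m - r ≤ m := Nat.sub_le m r
      push_cast [Nat.cast_sub hr]; linarith [(Nat.cast_nonneg r : (0 : ℝ) ≤ r)]
    linarith [mul_comm (resCount m r N : ℝ) ((m + 1 : ℕ) : ℝ)]
  have hlo : ∀ N : ℕ, (N : ℝ) - (m + 1) ≤ ((m + 1 : ℕ) : ℝ) * resCount m r N := fun N => by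
    have hK : N ≤ resCount m r N * (m + 1) + m := by
      have h := Nat.div_add_mod' (N + (m - r)) (m + 1)
      have hlt := Nat.mod_lt (N + (m - r)) (by omega : 0 < m + 1)
      unfold resCount
      omega
    have h' : (N : ℝ) ≤ (resCount m r N : ℝ) * (m + 1 : ℕ) + m := by exact_mod_cast hK
    push_cast at h' ⊢
    nlinarith
  have hm' : (0 : ℝ) < (m + 1 : ℕ) := by positivity
  -- squeeze between `(N − (m+1))/((m+1) N)` and `(N + m)/((m+1) N)`
  have hlim_lo : Tendsto (fun N : ℕ => ((N : ℝ) - (m + 1)) / ((m + 1 : ℕ) * N)) atTop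
      (𝓝 (1 / (m + 1 : ℝ))) := by
    have h : Tendsto (fun N : ℕ => 1 / (m + 1 : ℝ) - (N : ℝ)⁻¹) atTop (𝓝 (1 / (m + 1 : ℝ))) := by
      simpa using tendsto_const_nhds.sub (tendsto_inv_atTop_nhds_zero_nat (𝕜 := ℝ))
    refine h.congr' ?_
    filter_upwards [eventually_gt_atTop 0] with N hN
    have hN' : (N : ℝ) ≠ 0 := by positivity
    have hm1 : ((m + 1 : ℕ) : ℝ) = (m : ℝ) + 1 := by push_cast; ring
    rw [hm1]
    field_simp
  have hlim_up : Tendsto (fun N : ℕ => ((N : ℝ) + m) / ((m + 1 : ℕ) * N)) atTop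
      (𝓝 (1 / (m + 1 : ℝ))) := by
    have h : Tendsto (fun N : ℕ => 1 / (m + 1 : ℝ) + (m / (m + 1 : ℝ)) * (N : ℝ)⁻¹) atTop
        (𝓝 (1 / (m + 1 : ℝ))) := by
      simpa using tendsto_const_nhds.add
        ((tendsto_inv_atTop_nhds_zero_nat (𝕜 := ℝ)).const_mul (m / (m + 1 : ℝ)))
    refine h.congr' ?_
    filter_upwards [eventually_gt_atTop 0] with N hN
    have hN' : (N : ℝ) ≠ 0 := by positivity
    have hm1 : ((m + 1 : ℕ) : ℝ) = (m : ℝ) + 1 := by push_cast; ring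
    rw [hm1]
    field_simp
  refine tendsto_of_tendsto_of_tendsto_of_le_of_le' hlim_lo hlim_up ?_ ?_
  · filter_upwards [eventually_gt_atTop 0] with N hN
    have hN' : (0 : ℝ) < N := Nat.cast_pos.2 hN
    rw [div_le_div_iff₀ (by positivity) hN']
    nlinarith [hlo N]
  · filter_upwards [eventually_gt_atTop 0] with N hN
    have hN' : (0 : ℝ) < N := Nat.cast_pos.2 hN
    rw [div_le_div_iff₀ hN' (by positivity)]
    nlinarith [hup N]

end Residues

/-! ## §2 The strong law -/

section StrongLaw

variable {Ω : Type*} [MeasurableSpace Ω] {P : Measure Ω}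
variable {S : Type*} [MeasurableSpace S] {ξ : ℕ → Ω → S} {m : ℕ} {F : (Fin (m + 1) → S) → ℝ}

/-- `S/N = (K/N) · (S/K)` for the sum over one residue class (both sides `0` when `K = 0` or `N = 0`). -/
theorem sum_div_eq_mul_div (f : ℕ → ℝ) (K N : ℕ) :
    (∑ k ∈ range K, f k) / N = ((K : ℝ) / N) * ((∑ k ∈ range K, f k) / K) := by
  rcases Nat.eq_zero_or_pos K with hK | hK
  · subst hK; simp
  · have hK' : (K : ℝ) ≠ 0 := by positivity
    field_simp

/-- **The decimated sequences are i.i.d.**: for each residue `r`, `k ↦ X_{k(m+1)+r}` is pairwise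
independent (windows `(m+1)`-apart are disjoint) … -/
theorem pairwise_indepFun_decimated (hξ : ∀ i, Measurable (ξ i)) (hind : iIndepFun ξ P)
    (hF : Measurable F) (r : ℕ) :
    Pairwise (Function.onFun (fun f g => IndepFun f g P) fun k => blockFactor F ξ (k * (m + 1) + r)) := by
  intro k k' hkk'
  rcases lt_or_gt_of_ne hkk' with h | h
  · exact indepFun_blockFactor hξ hind hF (by nlinarith)
  · exact (indepFun_blockFactor hξ hind hF (by nlinarith)).symm

/-- … and identically distributed with the law of `X_0`. -/
theorem identDistrib_decimated (hind : iIndepFun ξ P) (hid : ∀ i, IdentDistrib (ξ i) (ξ 0) P P)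
    (hF : Measurable F) (r k : ℕ) :
    IdentDistrib (blockFactor F ξ (k * (m + 1) + r)) (blockFactor F ξ (0 * (m + 1) + r)) P P :=
  (identDistrib_blockFactor hind hid hF _).trans (identDistrib_blockFactor hind hid hF _).symm

/-- **THE STRONG LAW FOR BLOCK-FACTOR PROCESSES.**  `ξ` i.i.d., `F` measurable,
`X_i = F(ξ_i, …, ξ_{i+m})` with `X_0` integrable.  Then `(1/N) Σ_{i<N} X_i → E X_0` almost surely.
(Decimate into the `m+1` residue classes; each is i.i.d., so Mathlib's strong law applies; reassemble
with `resCount/N → 1/(m+1)`.) -/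
theorem strong_law_blockFactor (hξ : ∀ i, Measurable (ξ i)) (hind : iIndepFun ξ P)
    (hid : ∀ i, IdentDistrib (ξ i) (ξ 0) P P) (hF : Measurable F)
    (h1 : Integrable (blockFactor F ξ 0) P) :
    ∀ᵐ ω ∂P, Tendsto (fun N : ℕ => (∑ i ∈ range N, blockFactor F ξ i ω) / N) atTop
      (𝓝 P[blockFactor F ξ 0]) := by
  -- the strong law in each residue class
  have hclass : ∀ r : Fin (m + 1), ∀ᵐ ω ∂P, Tendsto (fun K : ℕ =>
      (∑ k ∈ range K, blockFactor F ξ (k * (m + 1) + r) ω) / K) atTop (𝓝 P[blockFactor F ξ 0]) := by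
    intro r
    have hint : Integrable (blockFactor F ξ (0 * (m + 1) + r)) P :=
      (identDistrib_blockFactor hind hid hF _).symm.integrable_snd h1
    have h := strong_law_ae_real (fun k => blockFactor F ξ (k * (m + 1) + r)) hint
      (pairwise_indepFun_decimated hξ hind hF r) (identDistrib_decimated hind hid hF r)
    rw [integral_blockFactor hind hid hF] at h
    exact h
  rw [← ae_all_iff] at hclass
  filter_upwards [hclass] with ω hω
  -- reassemble
  have hm : ((m + 1 : ℕ) : ℝ) ≠ 0 := by positivity
  have e : (fun N : ℕ => (∑ i ∈ range N, blockFactor F ξ i ω) / N)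
      = fun N : ℕ => ∑ r ∈ range (m + 1), ((resCount m r N : ℝ) / N)
          * ((∑ k ∈ range (resCount m r N), blockFactor F ξ (k * (m + 1) + r) ω) / resCount m r N) := by
    funext N
    rw [sum_range_eq_sum_residues (fun i => blockFactor F ξ i ω) m N, sum_div]
    exact sum_congr rfl fun r _ => sum_div_eq_mul_div _ _ _
  rw [e]
  have hlim : ∀ r ∈ range (m + 1), Tendsto (fun N : ℕ => ((resCount m r N : ℝ) / N)
      * ((∑ k ∈ range (resCount m r N), blockFactor F ξ (k * (m + 1) + r) ω) / resCount m r N))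
      atTop (𝓝 ((1 / (m + 1 : ℝ)) * P[blockFactor F ξ 0])) := by
    intro r hr
    have hr' : r ≤ m := Nat.le_of_lt_succ (mem_range.1 hr)
    refine (tendsto_resCount_div hr').mul ?_
    exact (hω ⟨r, mem_range.1 hr⟩).comp (tendsto_resCount_atTop m r)
  have h := tendsto_finsetSum (range (m + 1)) hlim
  simp only [sum_const, card_range, nsmul_eq_mul] at h
  convert h using 2
  push_cast
  field_simp

end StrongLaw

/-! ## §3 Almost-sure consistency of the empirical autocovariances and of every windowed `τ̂_N(W)` -/

section Consistency

variable {Ω : Type*} [MeasurableSpace Ω] {P : Measure Ω}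
variable {S : Type*} [MeasurableSpace S] {ξ : ℕ → Ω → S} {m : ℕ} {F : (Fin (m + 1) → S) → ℝ}

/-- **`Γ̂_N(t) → c(t) = E[X_0 X_t]` almost surely, at every lag** (the lag products are block factors
on windows of length `m + t + 1`; integrable lag products suffice). -/
theorem ae_tendsto_acovHat_blockFactor (hξ : ∀ i, Measurable (ξ i)) (hind : iIndepFun ξ P)
    (hid : ∀ i, IdentDistrib (ξ i) (ξ 0) P P) (hF : Measurable F)
    (h1 : ∀ t, Integrable (fun ω => blockFactor F ξ 0 ω * blockFactor F ξ t ω) P) (t : ℕ) :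
    ∀ᵐ ω ∂P, Tendsto (fun N : ℕ => acovHat (blockFactor F ξ) N t ω) atTop
      (𝓝 P[fun ω => blockFactor F ξ 0 ω * blockFactor F ξ t ω]) := by
  have hlp : ∀ i, blockFactor (lagProdFactor F t (Fin.last t)) ξ i
      = fun ω => blockFactor F ξ i ω * blockFactor F ξ (i + t) ω := fun i => by
    rw [blockFactor_lagProdFactor]; simp only [Fin.val_last]
  have h1' : Integrable (blockFactor (lagProdFactor F t (Fin.last t)) ξ 0) P := by
    rw [hlp 0]; simpa only [zero_add] using h1 t
  have h := strong_law_blockFactor (m := m + t) hξ hind hid (measurable_lagProdFactor hF t (Fin.last t)) h1'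
  simp only [hlp, zero_add] at h
  filter_upwards [h] with ω hω
  simpa only [acovHat_apply] using hω

/-- **`τ̂_N(W) → τ_W` almost surely, SIMULTANEOUSLY for every window `W`** (`c(0) ≠ 0`):
`tauIntWindow (Γ̂_N(·)/Γ̂_N(0)) W → tauIntWindow (c(·)/c(0)) W`. -/
theorem ae_tendsto_tauIntWindow_blockFactor (hξ : ∀ i, Measurable (ξ i)) (hind : iIndepFun ξ P)
    (hid : ∀ i, IdentDistrib (ξ i) (ξ 0) P P) (hF : Measurable F)
    (h1 : ∀ t, Integrable (fun ω => blockFactor F ξ 0 ω * blockFactor F ξ t ω) P)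
    (hσ : P[fun ω => blockFactor F ξ 0 ω * blockFactor F ξ 0 ω] ≠ 0) :
    ∀ᵐ ω ∂P, ∀ W : ℕ, Tendsto (fun N : ℕ => tauIntWindow (fun t => acovHat (blockFactor F ξ) N t ω
        / acovHat (blockFactor F ξ) N 0 ω) W) atTop
      (𝓝 (tauIntWindow (fun t => P[fun ω => blockFactor F ξ 0 ω * blockFactor F ξ t ω]
        / P[fun ω => blockFactor F ξ 0 ω * blockFactor F ξ 0 ω]) W)) := by
  have hall := ae_all_iff.2 fun t => ae_tendsto_acovHat_blockFactor hξ hind hid hF h1 t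
  filter_upwards [hall] with ω hω W
  simp only [tauIntWindow]
  exact tendsto_const_nhds.add (tendsto_finsetSum _ fun t _ => (hω (t + 1)).div (hω 0) hσ)

end Consistency

/-! ## §4 The data-chosen window FREEZES: almost surely, `w` is eventually the Madras–Sokal window of `τ̂_N(·)` -/

section Freezing

variable {Ω : Type*} [MeasurableSpace Ω] {P : Measure Ω}

/-- **Almost-sure freezing (abstract form).**  If `τ̂_N(W) → τ_W` almost surely for every `W` and the
population curve has a STRICT Madras–Sokal window `w` at `c > 0`, then almost surely `w` IS the
Madras–Sokal window of the empirical curve `W ↦ τ̂_N(W)` for all large `N` (the margin of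
`IsStrictMSWindow.exists_margin` is eventually respected at the finitely many `W ≤ w`). -/
theorem ae_eventually_isMSWindow {τhat : ℕ → ℕ → Ω → ℝ} {τW : ℕ → ℝ} {c : ℝ} {w : ℕ}
    (hc : 0 < c) (hw : IsStrictMSWindow c τW w)
    (hconv : ∀ᵐ ω ∂P, ∀ W, Tendsto (fun N => τhat N W ω) atTop (𝓝 (τW W))) :
    ∀ᵐ ω ∂P, ∀ᶠ N in atTop, IsMSWindow c (fun W => τhat N W ω) w := by
  obtain ⟨δ, hδ, hmargin⟩ := hw.exists_margin hc
  filter_upwards [hconv] with ω hω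
  -- eventually every `W ≤ w` is within `δ`
  have hev : ∀ W ∈ Finset.Icc 1 w, ∀ᶠ N in atTop, |τhat N W ω - τW W| < δ := fun W _ =>
    (Metric.tendsto_nhds.1 (hω W)) δ hδ
  have hall := (Finset.eventually_all (Finset.Icc 1 w)).2 hev
  filter_upwards [hall] with N hN
  exact hmargin _ fun W h1 h2 => hN W (Finset.mem_Icc.2 ⟨h1, h2⟩)

/-- **Hence any admissible selector freezes at `w`**: if `Ŵ_N(ω)` returns `w` whenever `w` is the MS
window of `τ̂_N(·)(ω)` (scorer B's `ms_window` with `w ≤ W_max`), then almost surely `Ŵ_N = w` for all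
large `N`. -/
theorem ae_eventually_windowSel_eq {τhat : ℕ → ℕ → Ω → ℝ} {τW : ℕ → ℝ} {c : ℝ} {w : ℕ}
    {Wsel : ℕ → Ω → ℕ} (hc : 0 < c) (hw : IsStrictMSWindow c τW w)
    (hconv : ∀ᵐ ω ∂P, ∀ W, Tendsto (fun N => τhat N W ω) atTop (𝓝 (τW W)))
    (hsel : ∀ N ω, IsMSWindow c (fun W => τhat N W ω) w → Wsel N ω = w) :
    ∀ᵐ ω ∂P, ∀ᶠ N in atTop, Wsel N ω = w := by
  filter_upwards [ae_eventually_isMSWindow hc hw hconv] with ω hω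
  exact hω.mono fun N hN => hsel N ω hN

variable {S : Type*} [MeasurableSpace S] {ξ : ℕ → Ω → S} {m : ℕ} {F : (Fin (m + 1) → S) → ℝ}

/-- **THE WINDOW FREEZES FOR BLOCK-FACTOR DATA.**  `ξ` i.i.d., `X_i = F(ξ_i..ξ_{i+m})` with
integrable lag products and `c(0) ≠ 0`; if the population curve `W ↦ τ_W` has a strict Madras–Sokal
window `w` at `c > 0`, then almost surely `w` is the MS window of `τ̂_N(·)` for all large `N` — the
statistic at the data-chosen window then COINCIDES with the fixed-window statistic `τ̂_N(w)`
eventually (stronger than `MadrasSokalDataWindow`'s `P(Ŵ_N ≠ w) → 0`). -/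
theorem ae_eventually_isMSWindow_blockFactor (hξ : ∀ i, Measurable (ξ i)) (hind : iIndepFun ξ P)
    (hid : ∀ i, IdentDistrib (ξ i) (ξ 0) P P) (hF : Measurable F)
    (h1 : ∀ t, Integrable (fun ω => blockFactor F ξ 0 ω * blockFactor F ξ t ω) P)
    (hσ : P[fun ω => blockFactor F ξ 0 ω * blockFactor F ξ 0 ω] ≠ 0) {c : ℝ} (hc : 0 < c) {w : ℕ}
    (hw : IsStrictMSWindow c (fun W => tauIntWindow (fun t =>
      P[fun ω => blockFactor F ξ 0 ω * blockFactor F ξ t ω]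
        / P[fun ω => blockFactor F ξ 0 ω * blockFactor F ξ 0 ω]) W) w) :
    ∀ᵐ ω ∂P, ∀ᶠ N in atTop, IsMSWindow c (fun W => tauIntWindow (fun t =>
      acovHat (blockFactor F ξ) N t ω / acovHat (blockFactor F ξ) N 0 ω) W) w :=
  ae_eventually_isMSWindow (τhat := fun N W ω => tauIntWindow (fun t =>
      acovHat (blockFactor F ξ) N t ω / acovHat (blockFactor F ξ) N 0 ω) W) hc hw
    (ae_tendsto_tauIntWindow_blockFactor hξ hind hid hF h1 hσ)

end Freezing

end Summit.Ventures.LatticeQCDFlow.Scoring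

end
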